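import Mathlib
import Summits.Schanuel.Schanuel.Theses.RigidCore
import Literature.NumberTheory.Transcendental.ExpPointsShapiroModel
import Literature.NumberTheory.Transcendental.LindemannWeierstrassProofs

/-!
# Crux `RigidCore.SparsityTwo` (stmt-Schanuel-0971) — line `galois-norm-branch-defect`

Skeleton (crux-plan, round 1) for the crux-idea card
`Cruxes/SparsityTwo/Ideas/galois-norm-branch-defect.md` (triage r1-1/2/3: pass ×3).

**The crux.** `SparsityTwo : ∀ W ⊆ ℂ² × ℂ², IsDefinedOver ⊥ W → zariskiDim ℂ W < 2 →
{x | LinearIndependent ℚ x ∧ (x, eˣ) ∈ W}.Finite`.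

**The line (five registered stubs, composition `SparsityTwo_of` kernel-checked).**
Contrapositive throughout: an infinite family of ℚ-independent exponential points is pushed through

1. `stub_unitaryAxisReduction` — the GEOMETRIC reduction (retired route ModulusFirst's chain
   ModulusArcDichotomy → DisconnectedModulusSetFinite → SymmetricAlgebraicIsUnitary →
   OffAxisFiniteness, plus its glue FinitenessTwoFeedsSparsityTwo; engine replaceable by card
   `puncture-log-analytic-rigidity`): infinitely many independent hits on a ℚ-closed `W` of
   dimension `< 2` force infinitely many ℚ-independent AXIS hits `(it, e^{it})`, `t ∈ ℝ²`, on one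
   geometrically irreducible, non-degenerate, unitary-symmetric ℚ̄-curve `W' ⊆ W` (hypotheses typed
   verbatim as in `ModulusFirst.UnitaryAxisFiniteness`).
2. `stub_endJetNormalForm` — the ANALYTIC reduction (Puiseux at a real place at infinity of the real
   form of `W'`, phases `y_j = ω_j e^{iψ_j}`, Ax–Schanuel against arcs of hits, symmetries
   `x ↦ -x` / coordinate swap): infinitely many axis hits accumulate at an END whose hit equation is
   `Φ(arg ω₁ + 2πK) = arg ω₂ + 2πL`, `Φ(T) = P(T^{1/E}) + h(T^{-1/E})`, with `ω_j ∈ ℚ̄` unimodular,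
   `P ∈ (ℚ̄ ∩ ℝ)[X]`, `h` real-analytic at `0`, `h 0 = 0`, ALGEBRAIC Taylor coefficients — the only
   transcendental in sight is the period `2π` (the card's lever input). Output as a dichotomy:
   either the end is LINEAR–UNRAMIFIED–HOMOGENEOUS (torsion phases, `Φ(T) = βT + g(1/T)`,
   `β ∉ ℚ`), delivered after the torsion normalisation directly as the integer-point problem
   `N - βM = g(1/(2πM))/(2π)` of the card, or it is a non-degenerate WILD jet (everything else).
3. `stub_normDescent` — THE LEVER of the card (Theorem P without Pell orbits, any degree, with the
   vanishing-coefficient class; provable now): for `β` real algebraic irrational of degree `d` and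
   such a `g`, the Galois norm `n_M = F_β(M, N) ∈ ℤ` of a solution equals `Q(M) + O(1/M)` with
   `Q ∈ ℝ[T]`, `deg Q ≤ d - 2`, every coefficient of the form `a·π^{-m}` (`a ∈ ℚ̄ ∩ ℝ`, `m ≥ 2`);
   `Q = 0` gives `n_M = 0`, a rational root of the minimal polynomial — so: the solution set is
   FINITE, or it lies in the norm shadow `{|N - βM| ≤ C/|M| ∧ ∃ n ∈ ℤ, |n - Q(M)| ≤ C/|M|}` of a
   NONZERO such `Q`.
4. `constShadow_finite` + `algebraic_div_pi_pow_ne_int` — PROVED here: a constant nonzero `Q`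
   (`d = 2`: the model pair `shapiroW`, every real-quadratic torsion cusp; and `ord ≥ d - 1` in any
   degree) has a finite shadow, because `a/π^{m+2} ∉ ℤ` by Lindemann (`transcendental_pi_holds`,
   tree, PROVED) — this is where ℚ̄-definedness is consumed a second time.
5. `stub_normShadowAtom` — the card's ATOM `Sim(β, κ)` generalised (open; Littlewood-flavoured
   simultaneous approximation of an algebraic `β` and a Weyl polynomial with period-type
   coefficients): for `deg Q ≥ 1` the shadow is finite.
6. `stub_wildJetAtoms` — the complement atoms (open cores: inhomogeneous Baker-period shifts =
   PellOrbitShapiro.NonTorsionPhaseFiniteness, super/sub-linear and ramified ends = Weyl targets of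
   card function-field-heights-finite-type; provable pockets: rational slope by Runge, `h` polynomial
   by Lindemann): a non-degenerate wild jet has finitely many solutions.

`SparsityTwo_of : RigidCore.SparsityTwo` chains 1 → 2 → (3 → 4 | 5) | 6 by name; its only `sorry`s
are the five stubs'. Disproof used: see the line card (`Lines/galois-norm-branch-defect.md`).
-/

namespace Summit.Schanuel.Schanuel.Cruxes.SparsityTwo.GaloisNormBranchDefect

open scoped Real
open Literature.NumberTheory.Transcendental

noncomputable section

/-! ## Stub 1 — geometric reduction to the unitary axis (ModulusFirst chain) -/

/-- **Stub 1 (axis confinement; size L; not this card's lever — its input).** If a ℚ-closed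
`W ⊆ ℂ² × ℂ²` with `zariskiDim ℂ W < 2` carries infinitely many ℚ-linearly independent exponential
points, then some geometrically irreducible ℚ̄-curve `W' ⊆ W` that is NON-DEGENERATE (x-projection in
no translate of a rational line) and UNITARY-SYMMETRIC (invariant under `τ₀(x, y) = (-x̄, 1/ȳ)` on the
torus) carries infinitely many ℚ-independent AXIS points `(it, e^{it})`, `t ∈ ℝ²`.
Content: ℚ̄-decomposition of `W`; degenerate components carry finitely many independent hits
(`y^q = e^κ`, Hermite–Lindemann `transcendental_exp_holds`); non-symmetric components have a totally
disconnected modulus set (Schwarz reflection = `ModulusFirst.ModulusArcDichotomy`, or the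
definability-free engine `LogAnalyticGermRigidity` of card puncture-log-analytic-rigidity) hence
finitely many hits (Khovanskii, tree `exists_forall_encard_components_zeroSetR_le`); a `τ_c`-symmetric
ℚ̄-curve has `c = 0` (`SymmetricAlgebraicIsUnitary`: H–L + `baker_holds`); off-axis hits of a
unitary-symmetric curve are finite (`OffAxisFiniteness`). Hypotheses on `W'` are typed verbatim as in
`ModulusFirst.UnitaryAxisFiniteness` (stmt-Schanuel-4147, retired-moot, NOT refuted). -/
theorem stub_unitaryAxisReduction :
    ∀ (W : Set (Fin 2 ⊕ Fin 2 → ℂ)), IsDefinedOver (⊥ : Subfield ℂ) W → zariskiDim ℂ W < 2 →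
      Set.Infinite {x : Fin 2 → ℂ | LinearIndependent ℚ x ∧ Sum.elim x (Complex.exp ∘ x) ∈ W} →
      ∃ W' : Set (Fin 2 ⊕ Fin 2 → ℂ), W' ⊆ W ∧ IsIrreducibleClosed ℂ W' ∧ zariskiDim ℂ W' = 1 ∧
        IsDefinedOver (algebraicClosure ℚ ℂ).toSubfield W' ∧
        ¬ (∃ q : Fin 2 → ℤ, q ≠ 0 ∧ ∃ κ : ℂ, ∀ p ∈ W', ∑ i, (q i : ℂ) * p (Sum.inl i) = κ) ∧
        (∀ p ∈ W', (∀ i, p (Sum.inr i) ≠ 0) →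
          Sum.elim (fun i => -(starRingEnd ℂ) (p (Sum.inl i)))
            (fun i => ((starRingEnd ℂ) (p (Sum.inr i)))⁻¹) ∈ W') ∧
        Set.Infinite {t : Fin 2 → ℝ | LinearIndependent ℚ t ∧
          Sum.elim (fun i => (t i : ℂ) * Complex.I) (fun i => Complex.exp ((t i : ℂ) * Complex.I)) ∈ W'} := by
  sorry

/-! ## Stub 2 — analytic reduction: the end-jet normal form (only `2π` is transcendental) -/

/-- **Stub 2 (end-jet normal form; size L).** On a geometrically irreducible, non-degenerate,
unitary-symmetric ℚ̄-curve `W'`, infinitely many ℚ-independent axis hits `(it, e^{it})` accumulate at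
a real place at infinity of the real form (no finite accumulation: an arc of hits would put a branch of
`W'` inside the graph of `exp`, and Ax–Schanuel `ax_schanuel_holds` makes `W'` degenerate). After the
symmetries `x ↦ -x, y ↦ 1/y` and the coordinate swap (which preserve every hypothesis), `t₁ → +∞`
along the end; Puiseux at the place (`t₁ = s^{-E}`, `t₂`, and the phases `ψ_j` of
`y_j = ω_j e^{iψ_j}`, `ω_j = y_j(place) ∈ ℚ̄` unimodular, all convergent series in `s` with REAL
ALGEBRAIC coefficients) turns the hit condition into `Φ(T_K) = arg ω₂ + 2πL` with
`T_K := t₁ - ψ₁ = arg ω₁ + 2πK > 0` and `Φ(T) = P(T^{1/E}) + h(T^{-1/E})`, `P ∈ (ℚ̄ ∩ ℝ)[X]`,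
`h` analytic at `0`, `h 0 = 0`, algebraic Taylor coefficients. Non-degeneracy of `W'` gives
`Φ ≢ rT + c` (`r ∈ ℚ`): else `e^{q x₂ - p x₁}` would be algebraic on `W'`. DICHOTOMY of the output:
(LUH) torsion phases and `Φ(T) = βT + g(1/T)` with `β ∉ ℚ` (a rational `β` with `g ≢ 0` has finitely
many solutions by Runge's remark: `qN - pM ∈ ℤ` tends to `0`) — delivered, after the torsion
normalisation `M = q(K + θ₁)`, `N = q(L + θ₂)` and rescaling of `g`, as the card's integer-point
problem `N - βM = g(1/(2πM))/(2π)`; or (WILD) anything else, delivered as the raw jet. -/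
theorem stub_endJetNormalForm :
    ∀ (W' : Set (Fin 2 ⊕ Fin 2 → ℂ)), IsIrreducibleClosed ℂ W' → zariskiDim ℂ W' = 1 →
      IsDefinedOver (algebraicClosure ℚ ℂ).toSubfield W' →
      ¬ (∃ q : Fin 2 → ℤ, q ≠ 0 ∧ ∃ κ : ℂ, ∀ p ∈ W', ∑ i, (q i : ℂ) * p (Sum.inl i) = κ) →
      (∀ p ∈ W', (∀ i, p (Sum.inr i) ≠ 0) →
        Sum.elim (fun i => -(starRingEnd ℂ) (p (Sum.inl i)))
          (fun i => ((starRingEnd ℂ) (p (Sum.inr i)))⁻¹) ∈ W') →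
      Set.Infinite {t : Fin 2 → ℝ | LinearIndependent ℚ t ∧
        Sum.elim (fun i => (t i : ℂ) * Complex.I) (fun i => Complex.exp ((t i : ℂ) * Complex.I)) ∈ W'} →
      (∃ (β : ℝ) (g : ℝ → ℝ), IsAlgebraic ℚ β ∧ Irrational β ∧ AnalyticAt ℝ g 0 ∧ g 0 = 0 ∧
          (∀ n : ℕ, IsAlgebraic ℚ (iteratedDeriv n g 0)) ∧
          Set.Infinite {p : ℤ × ℤ | p.1 ≠ 0 ∧
            (p.2 : ℝ) - β * p.1 = g (1 / (2 * π * p.1)) / (2 * π)}) ∨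
      (∃ (ω₁ ω₂ : ℂ) (E : ℕ) (P : Polynomial ℝ) (h : ℝ → ℝ),
          IsAlgebraic ℚ ω₁ ∧ IsAlgebraic ℚ ω₂ ∧ ‖ω₁‖ = 1 ∧ ‖ω₂‖ = 1 ∧ 0 < E ∧
          (∀ n : ℕ, IsAlgebraic ℚ (P.coeff n)) ∧ AnalyticAt ℝ h 0 ∧ h 0 = 0 ∧
          (∀ n : ℕ, IsAlgebraic ℚ (iteratedDeriv n h 0)) ∧
          ¬ (∃ (r : ℚ) (c : ℝ), ∀ᶠ T in Filter.atTop,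
              P.eval (T ^ ((1 : ℝ) / E)) + h (T ^ (-(1 : ℝ) / E)) = r * T + c) ∧
          ¬ ((∃ n : ℕ, 0 < n ∧ ω₁ ^ n = 1 ∧ ω₂ ^ n = 1) ∧
              ∃ (β : ℝ) (g : ℝ → ℝ), Irrational β ∧ AnalyticAt ℝ g 0 ∧ g 0 = 0 ∧
                ∀ᶠ T in Filter.atTop,
                  P.eval (T ^ ((1 : ℝ) / E)) + h (T ^ (-(1 : ℝ) / E)) = β * T + g (1 / T)) ∧
          Set.Infinite {p : ℤ × ℤ | 0 < Complex.arg ω₁ + 2 * π * p.1 ∧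
            P.eval ((Complex.arg ω₁ + 2 * π * p.1) ^ ((1 : ℝ) / E)) +
                h ((Complex.arg ω₁ + 2 * π * p.1) ^ (-(1 : ℝ) / E)) =
              Complex.arg ω₂ + 2 * π * p.2}) := by
  sorry

/-! ## Stub 3 — THE LEVER: Galois norm of the branch defect -/

/-- **Stub 3 (norm descent; size M; provable now — the card's Theorem (i)+(ii), effective).**
Let `β` be real algebraic irrational (minimal polynomial `f`, degree `d ≥ 2`, primitive integer
multiple `F`) and `g` real-analytic at `0` with `g 0 = 0` and algebraic Taylor coefficients. Along the
solutions `(M, N) ∈ ℤ²`, `M ≠ 0`, of `N - βM = g(1/(2πM))/(2π)` one has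
`N - βM = Σ_{j ≥ 1} a_j M^{-j}` with `a_j = (g⁽ʲ⁾(0)/j!)(2π)^{-j-1} ∈ ℚ̄·π^{-j-1}`, and the INTEGER
`n_M := F(M, N) = M^d F(N/M) = c_d ∏_σ (N - σ(β)M)` expands as
`n_M = Σ_{m ≥ 2} c'_m M^{d-m}`, `c'_m = (2π)^{-m}·(algebraic)` (a term `e_i a_{j₁}⋯a_{j_i}` has
`i + Σ j_l = m`): so `n_M = Q(M) + O(1/|M|)` with `Q(T) = Σ_{m=2}^{d} c'_m T^{d-m} ∈ ℝ[T]`, each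
coefficient `a·π^{-m}`, `a ∈ ℚ̄ ∩ ℝ`, `m ≥ 2`. If `Q = 0`: `|n_M| < 1` eventually, `n_M = 0`,
`F(N/M) = 0` — a rational root of the minimal polynomial of the irrational `β`: no large solution.
Else the solutions lie in the NORM SHADOW of `Q` (small `|M|`: at most one `N` each, absorbed in `C`).
Triage sharpenings honoured: error `C/|M|` (no parity of the tail needed, r1-3); non-integrality
rather than irrationality is what is used downstream (r1-1). Contains
`PellOrbitShapiro.QuadraticSlopeFiniteness`' bounded-norm step (stmt-7106) without unit orbits. -/
theorem stub_normDescent :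
    ∀ (β : ℝ) (g : ℝ → ℝ), IsAlgebraic ℚ β → Irrational β → AnalyticAt ℝ g 0 → g 0 = 0 →
      (∀ n : ℕ, IsAlgebraic ℚ (iteratedDeriv n g 0)) →
      Set.Finite {p : ℤ × ℤ | p.1 ≠ 0 ∧
          (p.2 : ℝ) - β * p.1 = g (1 / (2 * π * p.1)) / (2 * π)} ∨
      ∃ (Q : Polynomial ℝ) (C : ℝ), Q ≠ 0 ∧
        (∀ i : ℕ, ∃ (a : ℝ) (m : ℕ), IsAlgebraic ℚ a ∧ Q.coeff i = a / π ^ (m + 2)) ∧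
        {p : ℤ × ℤ | p.1 ≠ 0 ∧ (p.2 : ℝ) - β * p.1 = g (1 / (2 * π * p.1)) / (2 * π)} ⊆
          {p : ℤ × ℤ | p.1 ≠ 0 ∧ |(p.2 : ℝ) - β * p.1| ≤ C / |(p.1 : ℝ)| ∧
            ∃ n : ℤ, |(n : ℝ) - Q.eval (p.1 : ℝ)| ≤ C / |(p.1 : ℝ)|} := by
  sorry

/-! ## Stub 4 — the card's atom `Sim(β, κ)`, generalised to Weyl–Lindemann targets (open) -/

/-- **Stub 4 (norm-shadow atom; OPEN — the honest residue of the lever).** For `β` real algebraic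
irrational and a NON-CONSTANT `Q ∈ ℝ[T]` all of whose coefficients have the form `a/π^{m+2}`
(`a ∈ ℚ̄ ∩ ℝ`; the leading one is then transcendental, so `{Q(M)}` is Weyl-equidistributed), only
finitely many `M` are SIMULTANEOUSLY within `C/|M|` of the line of slope `β` and of an integer value of
`Q`. Degree `1`, `Q = κT + λ` (`d = 3`): the card's `Sim(β, κ_W)`, `κ_W = -f'(β)a₁/π²` — `M` must be a
convergent-quality denominator of the algebraic `β` AND of the period-type `κ_W`; degree `≥ 2`
(`d ≥ 4`): the recorded Weyl-polynomial variant. True for Lebesgue-a.e. `(β, Q)` (convergence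
Borel–Cantelli, `Σ (C/M)² < ∞`) and for `β, κ, λ` ALL algebraic (Schmidt subspace); open for one
period coefficient. The bet of the card: a joint statement about the continued fractions of an
algebraic number and of `ℚ̄·π⁻²`. Same object as PellOrbitShapiro's foreseen
`CubicScaleNonConvergence` and card resonance-depth-roth-sieve §4. -/
theorem stub_normShadowAtom :
    ∀ (β : ℝ), IsAlgebraic ℚ β → Irrational β → ∀ (Q : Polynomial ℝ) (C : ℝ), 0 < Q.natDegree →
      (∀ i : ℕ, ∃ (a : ℝ) (m : ℕ), IsAlgebraic ℚ a ∧ Q.coeff i = a / π ^ (m + 2)) →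
      Set.Finite {p : ℤ × ℤ | p.1 ≠ 0 ∧ |(p.2 : ℝ) - β * p.1| ≤ C / |(p.1 : ℝ)| ∧
        ∃ n : ℤ, |(n : ℝ) - Q.eval (p.1 : ℝ)| ≤ C / |(p.1 : ℝ)|} := by
  sorry

/-! ## Stub 5 — the complement: wild end jets (open cores, provable pockets) -/

/-- **Stub 5 (wild-jet atoms; OPEN in its cores — not this card's lever; sibling lines attack it).**
End-jet data: `ω₁, ω₂ ∈ ℚ̄` unimodular, `E ≥ 1`, `P ∈ (ℚ̄ ∩ ℝ)[X]`, `h` real-analytic at `0`,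
`h 0 = 0`, algebraic Taylor coefficients; hit set
`{(K, L) : T_K := arg ω₁ + 2πK > 0 ∧ P(T_K^{1/E}) + h(T_K^{-1/E}) = arg ω₂ + 2πL}`. If the jet is
NON-DEGENERATE (`Φ ≢ rT + c`, `r ∈ ℚ`) and NOT linear–unramified–homogeneous (not: torsion phases ∧
`Φ(T) = βT + g(1/T)` with `β ∉ ℚ`), the hit set is finite. Sub-sectors: (a) non-torsion phases with
`Φ = βT + c + g(1/T)`: the inhomogeneous atom `‖βK + (βθ₁ - θ₂ + c/2π)‖ = O(1/K)` with a Baker-period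
shift (= `PellOrbitShapiro.NonTorsionPhaseFiniteness`; Baker–Wüstholz bounds the depth, a linear form
in three logarithms at exponent `1` would be needed); (b) torsion phases but `c ≠ 0` (shift `c/2π`,
`c ∈ ℚ̄`: same type); (c) `deg P ≠ E` or ramified `P`/`h`: Weyl targets `‖ηT_K^ρ + …‖` (twist-curve
sector of card function-field-heights-finite-type, whose `ExactChainMonomialTwistFinite` PROVES the
`ψ₁ ≡ 0` pocket); (d) `β ∈ ℚ`: finite by Runge (`qL - pK` integral and tending to a limit forces
`h`-zeros to accumulate: cusp-germ card's `RationalJetRunge`) — provable pocket; (e) `h` polynomial: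
Lindemann elimination — provable pocket. For fixed `(ω, E, P)` a counterexample `h` would need
near-misses of unbounded depth (interpolation at `u_K → 0` pins one Taylor coefficient per order),
which Baker–Wüstholz (a) / Roth-type heuristics (c) forbid; the statement is the union of the other
cards' atoms in jet language. -/
theorem stub_wildJetAtoms :
    ∀ (ω₁ ω₂ : ℂ) (E : ℕ) (P : Polynomial ℝ) (h : ℝ → ℝ),
      IsAlgebraic ℚ ω₁ → IsAlgebraic ℚ ω₂ → ‖ω₁‖ = 1 → ‖ω₂‖ = 1 → 0 < E →
      (∀ n : ℕ, IsAlgebraic ℚ (P.coeff n)) → AnalyticAt ℝ h 0 → h 0 = 0 →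
      (∀ n : ℕ, IsAlgebraic ℚ (iteratedDeriv n h 0)) →
      ¬ (∃ (r : ℚ) (c : ℝ), ∀ᶠ T in Filter.atTop,
          P.eval (T ^ ((1 : ℝ) / E)) + h (T ^ (-(1 : ℝ) / E)) = r * T + c) →
      ¬ ((∃ n : ℕ, 0 < n ∧ ω₁ ^ n = 1 ∧ ω₂ ^ n = 1) ∧
          ∃ (β : ℝ) (g : ℝ → ℝ), Irrational β ∧ AnalyticAt ℝ g 0 ∧ g 0 = 0 ∧
            ∀ᶠ T in Filter.atTop,
              P.eval (T ^ ((1 : ℝ) / E)) + h (T ^ (-(1 : ℝ) / E)) = β * T + g (1 / T)) →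
      Set.Finite {p : ℤ × ℤ | 0 < Complex.arg ω₁ + 2 * π * p.1 ∧
        P.eval ((Complex.arg ω₁ + 2 * π * p.1) ^ ((1 : ℝ) / E)) +
            h ((Complex.arg ω₁ + 2 * π * p.1) ^ (-(1 : ℝ) / E)) =
          Complex.arg ω₂ + 2 * π * p.2} := by
  sorry

/-! ## Proved: the constant norm shadow (Lindemann) — `d = 2` and the `ord ≥ d - 1` class -/

/-- **Lindemann step (proved).** A nonzero real algebraic number divided by `π^{m+2}` is not an
integer: otherwise `π^{m+2} = a/n` would be algebraic, contradicting `transcendental_pi_holds`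
(tree, PROVED). This is the second place where ℚ̄-definedness of `W` is consumed (the would-be limit
of the integer norms `n_M` is `(algebraic)·π^{-m}`). -/
theorem algebraic_div_pi_pow_ne_int (a : ℝ) (ha : IsAlgebraic ℚ a) (ha0 : a ≠ 0) (m : ℕ) (n : ℤ) :
    a / π ^ (m + 2) ≠ (n : ℝ) := by
  intro h
  have hpi : (π : ℝ) ^ (m + 2) ≠ 0 := pow_ne_zero _ Real.pi_ne_zero
  have hn : (n : ℝ) ≠ 0 := by
    rw [← h]
    exact div_ne_zero ha0 hpi
  have h' : a = (n : ℝ) * π ^ (m + 2) := (div_eq_iff hpi).mp h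
  have hpow : (π : ℝ) ^ (m + 2) = a * (n : ℝ)⁻¹ := by
    rw [h', mul_comm (n : ℝ), mul_assoc, mul_inv_cancel₀ hn, mul_one]
  have hinv : IsAlgebraic ℚ ((n : ℝ)⁻¹) := by
    have := isAlgebraic_algebraMap (R := ℚ) (A := ℝ) ((n : ℚ)⁻¹)
    simpa using this
  have halg : IsAlgebraic ℚ ((π : ℝ) ^ (m + 2)) := by
    rw [hpow]
    exact ha.mul hinv
  have hT : Transcendental ℚ Real.pi := transcendental_pi_holds
  exact (hT.pow (Nat.succ_pos _)) halg

/-- `1 ≤ |M|` in `ℝ` for a nonzero integer `M`. -/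
theorem one_le_abs_intCast {M : ℤ} (hM : M ≠ 0) : (1 : ℝ) ≤ |(M : ℝ)| := by
  rw [← Int.cast_abs]
  exact_mod_cast Int.one_le_abs hM

/-- `C / |M| ≤ |C|` for a nonzero integer `M`. -/
theorem div_abs_intCast_le {M : ℤ} (hM : M ≠ 0) (C : ℝ) : C / |(M : ℝ)| ≤ |C| := by
  have hMpos : (0 : ℝ) < |(M : ℝ)| := abs_pos.mpr (Int.cast_ne_zero.mpr hM)
  rw [div_le_iff₀ hMpos]
  calc C ≤ |C| := le_abs_self C
    _ = |C| * 1 := (mul_one _).symm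
    _ ≤ |C| * |(M : ℝ)| := mul_le_mul_of_nonneg_left (one_le_abs_intCast hM) (abs_nonneg C)

/-- **The constant shadow is finite (proved).** If `c ∈ ℝ` is not an integer, then for every `C`
only finitely many `(M, N) ∈ ℤ²`, `M ≠ 0`, satisfy `|N - βM| ≤ C/|M|` together with
`∃ n ∈ ℤ, |n - c| ≤ C/|M|`: the admissible `n` lie in a finite window, and for each of them
`|M| ≤ C / |n - c|`, after which the first condition bounds `N`. With `c = a/π^{m+2}`,
`a ∈ ℚ̄ ∩ ℝ ∖ {0}` (`algebraic_div_pi_pow_ne_int`) this is the `d = 2` theorem of the card (every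
real-quadratic torsion cusp, in particular the disprover's calibration pair `shapiroW`:
`n = N'² - 2M² → -4/π²`) and the `ord ≥ d - 1` class in any degree, EFFECTIVELY. -/
theorem constShadow_finite (β c C : ℝ) (hc : ∀ n : ℤ, c ≠ (n : ℝ)) :
    Set.Finite {p : ℤ × ℤ | p.1 ≠ 0 ∧ |(p.2 : ℝ) - β * p.1| ≤ C / |(p.1 : ℝ)| ∧
      ∃ n : ℤ, |(n : ℝ) - c| ≤ C / |(p.1 : ℝ)|} := by
  -- for a FIXED integer `n` the two conditions confine `p` to a box
  have hbox : ∀ n : ℤ, Set.Finite {p : ℤ × ℤ | p.1 ≠ 0 ∧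
      |(p.2 : ℝ) - β * p.1| ≤ C / |(p.1 : ℝ)| ∧ |(n : ℝ) - c| ≤ C / |(p.1 : ℝ)|} := by
    intro n
    have hεpos : 0 < |(n : ℝ) - c| := abs_pos.mpr (sub_ne_zero.mpr (hc n).symm)
    set B : ℝ := C / |(n : ℝ) - c| with hB
    set B' : ℝ := |β| * B + |C| with hB'
    refine ((Set.finite_Icc (-⌈B⌉) ⌈B⌉).prod (Set.finite_Icc (-⌈B'⌉) ⌈B'⌉)).subset ?_
    rintro ⟨M, N⟩ ⟨hM0, hMN, hn⟩
    simp only at hM0 hMN hn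
    have hMpos : (0 : ℝ) < |(M : ℝ)| := abs_pos.mpr (Int.cast_ne_zero.mpr hM0)
    -- `|M| ≤ B`
    have hMle : |(M : ℝ)| ≤ B := by
      rw [hB, le_div_iff₀ hεpos]
      have h1 : |(n : ℝ) - c| * |(M : ℝ)| ≤ C := (le_div_iff₀ hMpos).mp hn
      linarith [mul_comm (|(n : ℝ) - c|) (|(M : ℝ)|)]
    -- `|N| ≤ B'`
    have hNle : |(N : ℝ)| ≤ B' := by
      have h1 : |(N : ℝ)| ≤ |β * (M : ℝ)| + |(N : ℝ) - β * M| := by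
        have := abs_add_le (β * (M : ℝ)) ((N : ℝ) - β * M)
        rwa [add_sub_cancel] at this
      have h2 : |β * (M : ℝ)| ≤ |β| * B := by
        rw [abs_mul]
        exact mul_le_mul_of_nonneg_left hMle (abs_nonneg β)
      have h3 : |(N : ℝ) - β * M| ≤ |C| := hMN.trans (div_abs_intCast_le hM0 C)
      rw [hB']
      linarith
    have hMI := abs_le.mp (hMle.trans (Int.le_ceil B))
    have hNI := abs_le.mp (hNle.trans (Int.le_ceil B'))
    refine Set.mem_prod.mpr ⟨Set.mem_Icc.mpr ⟨?_, ?_⟩, Set.mem_Icc.mpr ⟨?_, ?_⟩⟩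
    · exact_mod_cast hMI.1
    · exact_mod_cast hMI.2
    · exact_mod_cast hNI.1
    · exact_mod_cast hNI.2
  -- the admissible `n` lie in a finite window
  refine ((Set.finite_Icc ⌊c - |C|⌋ ⌈c + |C|⌉).biUnion fun n _ => hbox n).subset ?_
  rintro ⟨M, N⟩ ⟨hM0, hMN, n, hn⟩
  simp only at hM0 hMN hn
  have hnc : |(n : ℝ) - c| ≤ |C| := hn.trans (div_abs_intCast_le hM0 C)
  obtain ⟨h1, h2⟩ := abs_le.mp hnc
  refine Set.mem_iUnion₂.mpr ⟨n, Set.mem_Icc.mpr ⟨?_, ?_⟩, hM0, hMN, hn⟩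
  · have : (⌊c - |C|⌋ : ℝ) ≤ n := (Int.floor_le _).trans (by linarith)
    exact_mod_cast this
  · have : (n : ℝ) ≤ ⌈c + |C|⌉ := le_trans (by linarith) (Int.le_ceil _)
    exact_mod_cast this

/-! ## Composition — the line concludes the crux BY NAME -/

/-- **`SparsityTwo` from the five stubs** (kernel-checked; the stubs are invoked by name, so the only
`sorry`s in the cone of this theorem are theirs). Contrapositive: infinite independent hits ⟹ (stub 1)
infinite independent axis hits on a non-degenerate unitary-symmetric ℚ̄-curve ⟹ (stub 2) an infinite
LUH integer-point family or an infinite wild jet family; the former is finite by norm descent (stub 3)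
— outright, or via the constant shadow (proved, Lindemann), or via the norm-shadow atom (stub 4) —
and the latter by the wild-jet atoms (stub 5). -/
theorem SparsityTwo_of : Summit.Schanuel.Schanuel.Theses.RigidCore.SparsityTwo := by
  intro W hW hdim
  by_contra hinf
  obtain ⟨W', -, hirr, hdim1, hdef, hnd, hsym, hA⟩ := stub_unitaryAxisReduction W hW hdim hinf
  rcases stub_endJetNormalForm W' hirr hdim1 hdef hnd hsym hA with
    ⟨β, g, hβ, hβirr, hg, hg0, hgalg, hS⟩ |
    ⟨ω₁, ω₂, E, P, h, hω₁, hω₂, hu₁, hu₂, hE, hP, hh, hh0, hhalg, hndeg, hwild, hS⟩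
  · -- linear–unramified–homogeneous end: norm descent
    rcases stub_normDescent β g hβ hβirr hg hg0 hgalg with hfin | ⟨Q, C, hQ, hcoef, hsub⟩
    · exact hS hfin
    · by_cases hdeg : Q.natDegree = 0
      · -- constant nonzero `Q`: Lindemann
        obtain ⟨a, m, ha, hcoeff⟩ := hcoef 0
        have hQC : Q = Polynomial.C (Q.coeff 0) := Polynomial.eq_C_of_natDegree_eq_zero hdeg
        have ha0 : a ≠ 0 := by
          rintro rfl
          apply hQ
          rw [hQC, hcoeff, zero_div, map_zero]
        refine hS ((constShadow_finite β (a / π ^ (m + 2)) C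
          (algebraic_div_pi_pow_ne_int a ha ha0 m)).subset (hsub.trans ?_))
        rintro p ⟨hp0, hp1, n, hn⟩
        refine ⟨hp0, hp1, n, ?_⟩
        rwa [hQC, Polynomial.eval_C, hcoeff] at hn
      · exact hS ((stub_normShadowAtom β hβ hβirr Q C (Nat.pos_of_ne_zero hdeg) hcoef).subset hsub)
  · -- wild end
    exact hS (stub_wildJetAtoms ω₁ ω₂ E P h hω₁ hω₂ hu₁ hu₂ hE hP hh hh0 hhalg hndeg hwild)

end

end Summit.Schanuel.Schanuel.Cruxes.SparsityTwo.GaloisNormBranchDefect
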